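import Literature.NumberTheory.EllipticCurves.PAdicLFunctionMinus
import Literature.NumberTheory.EllipticCurves.PAdicLFunctionBranchConstantTermProofs
import Literature.NumberTheory.EllipticCurves.PAdicMeasureTransform
import HarnessLib

/-!
# The MINUS Mazur–Swinnerton-Dyer measure is a distribution, and the constant term of the odd
# branches `L_p(f, α, ω^i, T)` (proofs)

`Proofs` companion (theorems only; no definition, no named fact) of `PAdicLFunctionMinus` (the minus
measure `μ⁻_{f,α}(a + pⁿℤ_p) = α⁻ⁿ[a/pⁿ]⁻ − α⁻⁽ⁿ⁺¹⁾[a/pⁿ⁻¹]⁻` and the odd branches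
`padicLFunctionMinusBranch`, Mazur–Tate–Teitelbaum 1986 §I.10, §I.13), the MINUS twins of
`PAdicLFunctionDistributionProofs` (`sum_fiber_msdMeasure_succ_eq`) and
`PAdicLFunctionBranchConstantTermProofs` (`constantCoeff_padicLFunctionBranch_eq`):

* `cuspCoeff_mul_minusSymbol`, `intCast_mul_normalizedMinusSymbol`, `intCast_mul_ratMinusSymbol`:
  the Hecke relation `a_p [r]⁻ = ∑_{j mod p} [(r+j)/p]⁻ + [p r]⁻` (MTT (4.2) with §I.8), from the
  tree's `cuspCoeff_mul_modularSymbol` at `r` and `−r` (the minus symbol is the odd part of `{∞,·}`)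
  and the PROVED rationality `([r]⁻ : ℝ) = [r]⁻_f` (`ratCast_ratMinusSymbol`, Manin–Drinfeld);
* `sum_fiber_msdMinusMeasure_succ_eq`: **the distribution relation of `μ⁻_{f,α}`**
  (MTT §I.10 Prop. (10.2)) for a rational newform of level prime to `p` and a root `α ≠ 0` of
  `X² − a_p X + p`;
* (the iterated distribution relation and the level-lowering on units for ANY family `μ` are the
  tree's `sum_fiber_of_distribution`, `sum_units_mul_of_distribution`, file `PAdicMeasureTransform`);
* `constantCoeff_padicLFunctionMinusBranch_eq`: **the constant term of the odd branch** — for every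
  `n` the Riemann sum of the constant coefficient is the fixed finite sum
  `∑_{a ∈ (ℤ/p^{e₀})ˣ} μ⁻_{f,α}(a + p^{e₀}ℤ_p) ω(a)^i`, hence so is the `limUnder` (MTT §I.13: the Mellin
  transform at a tame character is a finite sum at level `p^{e₀}`).

Motivation: cell `b2b-bsdres`, seat additive-p4, line V14 (`Summits/…/Additive/X3RankZeroCyclotomicThree.lean`):
the value `L₃(V, ω, 0) = α⁻¹ ∑_{a mod 3} (a/3)[a/3]⁻_f` (hypothesis `hD1` there) is this constant term.

References: Mazur–Tate–Teitelbaum, Invent. Math. 84 (1986) §I.4 (4.2), §I.8, §I.10 (10.1)–(10.2),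
§I.13 [MazurTateTeitelbaum1986Invent]; Manin 1972, Cor. 3.6 [Manin1972].
-/

noncomputable section

open scoped MatrixGroups ModularForm

open CongruenceSubgroup Filter Topology Literature.NumberTheory.EllipticCurves.ModularForms

namespace Literature.NumberTheory.EllipticCurves

/-! ### The Hecke relation for the minus symbols -/

section MinusHecke

variable {N : ℕ} [NeZero N] (p : ℕ) [NeZero p]

/-- **The Hecke relation for the minus symbols**:
`a_p minusSymbol(r) = ∑_{j mod p} minusSymbol((r + j)/p) + minusSymbol(p r)` for `p ∤ N`
(from `cuspCoeff_mul_modularSymbol` at `r` and `−r`, reflecting the sum at `−r` with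
`{∞, x + 1} = {∞, x}`; twin of `cuspCoeff_mul_plusSymbol`). [cite: MazurTateTeitelbaum1986Invent, §I.4 (4.2)] -/
theorem cuspCoeff_mul_minusSymbol {f : CuspForm (Gamma0 N) 2} (hf : IsNewform0 f) (hp : p.Prime)
    (hpN : ¬ p ∣ N) (r : ℚ) :
    cuspCoeff f p * minusSymbol f r =
      ∑ j : Fin p, minusSymbol f ((r + j) / p) + minusSymbol f (p * r) := by
  have h1 := cuspCoeff_mul_modularSymbol p hf hp hpN r
  have h2 := cuspCoeff_mul_modularSymbol p hf hp hpN (-r)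
  have hrefl : ∑ j : Fin p, modularSymbol f ((-r + j) / p) =
      ∑ j : Fin p, modularSymbol f (-((r + j) / p)) := by
    rw [← sum_fin_reflect_of_periodic p (modularSymbol f) (fun x ↦ by
      exact_mod_cast modularSymbol_add_intCast_holds f x 1) (-r)]
    refine Finset.sum_congr rfl fun j _ ↦ ?_
    congr 1
    ring
  rw [hrefl] at h2
  have hsum : ∑ j : Fin p, minusSymbol f ((r + j) / p) =
      (∑ j : Fin p, modularSymbol f ((r + j) / p) -
        ∑ j : Fin p, modularSymbol f (-((r + j) / p))) / 2 := by
    simp only [minusSymbol]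
    rw [← Finset.sum_sub_distrib, Finset.sum_div]
  have hneg : modularSymbol f ((p : ℚ) * -r) = modularSymbol f (-((p : ℚ) * r)) := by
    rw [mul_neg]
  rw [hsum, minusSymbol, minusSymbol, mul_div_assoc', mul_sub, h1, h2, hneg]
  ring

/-- **The Hecke relation for the normalised minus symbols** `[r]⁻ = im minusSymbol(r) / Ω⁻`:
`a_p [r]⁻ = ∑_{j mod p} [(r + j)/p]⁻ + [p r]⁻` for `p ∤ N`, `a_p(f) = a_p ∈ ℤ`.
[cite: MazurTateTeitelbaum1986Invent, §I.4 (4.2) with §I.8] -/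
theorem intCast_mul_normalizedMinusSymbol {f : CuspForm (Gamma0 N) 2} (hf : IsNewform0 f)
    (hp : p.Prime) (hpN : ¬ p ∣ N) {ap : ℤ} (hap : cuspCoeff f p = ap) (r : ℚ) :
    (ap : ℝ) * normalizedMinusSymbol f r =
      ∑ j : Fin p, normalizedMinusSymbol f ((r + j) / p) + normalizedMinusSymbol f (p * r) := by
  have h := cuspCoeff_mul_minusSymbol p hf hp hpN r
  rw [hap] at h
  have him := congr_arg Complex.im h
  rw [show ((ap : ℤ) : ℂ) = ((ap : ℝ) : ℂ) by norm_cast, Complex.im_ofReal_mul, Complex.add_im,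
    Complex.im_sum] at him
  simp only [normalizedMinusSymbol]
  rw [mul_div_assoc', him, add_div, Finset.sum_div]

/-- **The Hecke relation for the rational minus symbols** `[r]⁻ = ratMinusSymbol f r`:
`a_p [r]⁻ = ∑_{j mod p} [(r + j)/p]⁻ + [p r]⁻` in `ℚ`, given the rationality
`([r]⁻ : ℝ) = [r]⁻` (hypothesis `hrat`; the tree's `ratCast_ratMinusSymbol` for rational newforms).
[cite: MazurTateTeitelbaum1986Invent, §I.4 (4.2) with §I.8, §I.10] -/
theorem intCast_mul_ratMinusSymbol {f : CuspForm (Gamma0 N) 2} (hf : IsNewform0 f) (hp : p.Prime)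
    (hpN : ¬ p ∣ N) {ap : ℤ} (hap : cuspCoeff f p = ap)
    (hrat : ∀ r : ℚ, (ratMinusSymbol f r : ℝ) = normalizedMinusSymbol f r) (r : ℚ) :
    (ap : ℚ) * ratMinusSymbol f r =
      ∑ j : Fin p, ratMinusSymbol f ((r + j) / p) + ratMinusSymbol f (p * r) := by
  apply Rat.cast_injective (α := ℝ)
  push_cast
  simp only [hrat]
  exact intCast_mul_normalizedMinusSymbol p hf hp hpN hap r

end MinusHecke

/-! ### The distribution relation of `μ⁻_{f,α}` -/

section MinusDistribution

variable {N : ℕ} [NeZero N] {p : ℕ} [Fact p.Prime]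

/-- **The distribution relation of the minus measure `μ⁻_{f,α}`** (Mazur–Tate–Teitelbaum 1986,
§I.10 Prop. (10.2), minus symbols): for a rational normalised newform `f` of level `N` prime to `p`
with `([r]⁻ : ℝ) = [r]⁻` (`hrat`), `a_p(f) = a_p ∈ ℤ` and `α ≠ 0` with `α² − a_p α + p = 0`,
`∑_{b ≡ a mod pⁿ} μ⁻(b + pⁿ⁺¹ℤ_p) = μ⁻(a + pⁿℤ_p)`. Verbatim the proof of the plus twin
`sum_fiber_msdMeasure_succ_eq` with `[·]⁻` for `[·]⁺`. [cite: MazurTateTeitelbaum1986Invent, §I.10 Prop. (10.2)] -/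
theorem sum_fiber_msdMinusMeasure_succ_eq {f : CuspForm (Gamma0 N) 2}
    (hrat : ∀ r : ℚ, (ratMinusSymbol f r : ℝ) = normalizedMinusSymbol f r) (hf : IsNewform0 f)
    (hpN : ¬ p ∣ N) {ap : ℤ} (hap : cuspCoeff f p = ap) {α : ℚ_[p]} (hα₀ : α ≠ 0)
    (hα : α ^ 2 - ap * α + p = 0) (n : ℕ) (a : ZMod (p ^ n)) :
    ∑ b ∈ Finset.univ.filter (fun b : ZMod (p ^ (n + 1)) ↦
        ZMod.castHom (pow_dvd_pow p n.le_succ) (ZMod (p ^ n)) b = a), msdMinusMeasure f α (n + 1) b =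
      msdMinusMeasure f α n a := by
  classical
  haveI : NeZero p := ⟨(Fact.out : p.Prime).ne_zero⟩
  have hp : p.Prime := Fact.out
  have hp0 : (p : ℚ) ≠ 0 := by exact_mod_cast hp.ne_zero
  have hinj : Function.Injective
      (fun j : Fin p ↦ ((a.val + p ^ n * (j : ℕ) : ℕ) : ZMod (p ^ (n + 1)))) := by
    intro j j' h
    have hv := congr_arg ZMod.val h
    simp only [val_classLift] at hv
    exact Fin.ext (Nat.eq_of_mul_eq_mul_left (pow_pos hp.pos n) (by omega))
  rw [filter_castHom_eq_image, Finset.sum_image fun j _ j' _ h ↦ hinj h]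
  set x : ℚ := (a.val : ℚ) / (p : ℚ) ^ n with hx
  have hA : ∀ j : Fin p, ((a.val + p ^ n * (j : ℕ) : ℕ) : ℚ) / (p : ℚ) ^ (n + 1) = (x + j) / p := by
    intro j
    rw [hx]
    push_cast
    field_simp
    ring
  have hB : ∀ j : Fin p, ratMinusSymbol f (((a.val + p ^ n * (j : ℕ) : ℕ) : ℚ) / (p : ℚ) ^ n) =
      ratMinusSymbol f x := by
    intro j
    have : ((a.val + p ^ n * (j : ℕ) : ℕ) : ℚ) / (p : ℚ) ^ n = x + ((j : ℕ) : ℤ) := by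
      rw [hx]
      push_cast
      field_simp
    rw [this, ratMinusSymbol_add_intCast]
  have hHecke := intCast_mul_ratMinusSymbol p hf hp hpN hap hrat x
  have hkey : α⁻¹ * (ap : ℚ_[p]) - (p : ℚ_[p]) * α⁻¹ ^ 2 = 1 := by
    field_simp
    linear_combination -hα
  have hsumq : ∑ j : Fin p, ratMinusSymbol f ((x + j) / p) =
      (ap : ℚ) * ratMinusSymbol f x - ratMinusSymbol f (p * x) := eq_sub_of_add_eq hHecke.symm
  have hsum : ∑ j : Fin p,
      msdMinusMeasure f α (n + 1) ((a.val + p ^ n * (j : ℕ) : ℕ) : ZMod (p ^ (n + 1))) =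
      α⁻¹ ^ (n + 1) * ((ap : ℚ_[p]) * (ratMinusSymbol f x : ℚ_[p]) -
          (ratMinusSymbol f (p * x) : ℚ_[p])) -
        α⁻¹ ^ (n + 2) * ((p : ℚ_[p]) * (ratMinusSymbol f x : ℚ_[p])) := by
    calc _ = ∑ j : Fin p, (α⁻¹ ^ (n + 1) * (ratMinusSymbol f ((x + j) / p) : ℚ_[p]) -
          α⁻¹ ^ (n + 2) * (ratMinusSymbol f x : ℚ_[p])) := by
          refine Finset.sum_congr rfl fun j _ ↦ ?_
          simp only [msdMinusMeasure, val_classLift, hA, hB]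
      _ = α⁻¹ ^ (n + 1) * ((∑ j : Fin p, ratMinusSymbol f ((x + j) / p) : ℚ) : ℚ_[p]) -
          α⁻¹ ^ (n + 2) * ((p : ℚ_[p]) * (ratMinusSymbol f x : ℚ_[p])) := by
          rw [Finset.sum_sub_distrib, ← Finset.mul_sum, ← Finset.mul_sum, Rat.cast_sum,
            Finset.sum_const, Finset.card_univ, Fintype.card_fin, nsmul_eq_mul]
      _ = _ := by
          rw [hsumq]
          push_cast
          ring
  rw [hsum]
  cases n with
  | zero =>
    haveI : Subsingleton (ZMod (p ^ 0)) := (ZMod.subsingleton_iff).mpr (pow_zero p)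
    have ha : a.val = 0 := by
      rw [Subsingleton.elim a 0, ZMod.val_zero]
    have hx0 : x = 0 := by rw [hx, ha]; simp
    have hpx : ratMinusSymbol f (p * x) = ratMinusSymbol f 0 := by rw [hx0, mul_zero]
    rw [hpx, hx0]
    simp only [msdMinusMeasure]
    linear_combination (ratMinusSymbol f 0 : ℚ_[p]) * hkey
  | succ m =>
    have hpx : (p : ℚ) * x = (a.val : ℚ) / (p : ℚ) ^ m := by
      rw [hx, show ((p : ℚ)) ^ (m + 1) = (p : ℚ) ^ m * p from pow_succ _ _]
      field_simp
    rw [hpx]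
    simp only [msdMinusMeasure]
    rw [← hx]
    linear_combination (α⁻¹ ^ (m + 1) * (ratMinusSymbol f x : ℚ_[p])) * hkey

/-- **The distribution relation of `μ⁻_{f,α}` for a RATIONAL NEWFORM, unconditionally**: the
rationality input `hrat` is the tree's PROVED `ratCast_ratMinusSymbol` (Manin–Drinfeld).
[cite: MazurTateTeitelbaum1986Invent, §I.10 Prop. (10.2)] [cite: Manin1972, Cor. 3.6] -/
theorem sum_fiber_msdMinusMeasure_succ_eq_of_coeffField {f : CuspForm (Gamma0 N) 2}
    (hf : IsNewform0 f) (hQ : coeffField f = ⊥)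
    (hpN : ¬ p ∣ N) {ap : ℤ} (hap : cuspCoeff f p = ap) {α : ℚ_[p]} (hα₀ : α ≠ 0)
    (hα : α ^ 2 - ap * α + p = 0) (n : ℕ) (a : ZMod (p ^ n)) :
    ∑ b ∈ Finset.univ.filter (fun b : ZMod (p ^ (n + 1)) ↦
        ZMod.castHom (pow_dvd_pow p n.le_succ) (ZMod (p ^ n)) b = a), msdMinusMeasure f α (n + 1) b =
      msdMinusMeasure f α n a :=
  sum_fiber_msdMinusMeasure_succ_eq (ratCast_ratMinusSymbol f hf hQ) hf hpN hap hα₀ hα n a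

end MinusDistribution

/-! ### The constant term of the odd branches -/

section MinusConstantTerm

variable {p : ℕ} [Fact p.Prime] {N : ℕ} {f : CuspForm (Gamma0 N) 2} {α : ℚ_[p]}

/-- **The Riemann sums for the constant term of the minus `ω^i`-branch are a fixed finite sum at
level `p^{e₀}`**: for every `n`,
`padicLMinusBranchRiemannSum f α i 0 n = ∑_{a ∈ (ℤ/p^{e₀})ˣ} μ⁻_{f,α}(a + p^{e₀}ℤ_p) · ω(a)^i`,
granted the distribution relation of `μ⁻_{f,α}` (`hdist`; `sum_fiber_msdMinusMeasure_succ_eq_of_coeffField`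
for rational newforms). Twin of `padicLBranchRiemannSum_zero_eq`.
[cite: MazurTateTeitelbaum1986Invent, §I.13] -/
theorem padicLMinusBranchRiemannSum_zero_eq
    (hdist : ∀ (n : ℕ) (a : ZMod (p ^ n)),
      ∑ b ∈ Finset.univ.filter (fun b : ZMod (p ^ (n + 1)) ↦
        ZMod.castHom (pow_dvd_pow p n.le_succ) (ZMod (p ^ n)) b = a), msdMinusMeasure f α (n + 1) b =
        msdMinusMeasure f α n a)
    (i n : ℕ) :
    padicLMinusBranchRiemannSum f α i 0 n =
      ∑ a : (ZMod (p ^ cyclotomicExponent p))ˣ,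
        msdMinusMeasure f α (cyclotomicExponent p) a *
          ((((teichRep p a : rootsOfUnity (torsionOrder p) ℤ_[p]) : ℤ_[p]ˣ) : ℤ_[p]) : ℚ_[p]) ^ i := by
  classical
  have hle : cyclotomicExponent p ≤ n + cyclotomicExponent p := Nat.le_add_left _ _
  have he : 1 ≤ cyclotomicExponent p := Nat.pos_of_ne_zero (cyclotomicExponent_ne_zero p)
  set G : ZMod (p ^ (n + cyclotomicExponent p)) → ℚ_[p] := fun u ↦
    RingHom.id ℚ_[p] (msdMinusMeasure f α (n + cyclotomicExponent p) u) *
      teichWeight p i (ZMod.castHom (pow_dvd_pow p hle) (ZMod (p ^ cyclotomicExponent p)) u) with hG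
  have h1 : padicLMinusBranchRiemannSum f α i 0 n =
      ∑ᶠ ζ : rootsOfUnity (torsionOrder p) ℤ_[p], ∑ s : ZMod (p ^ n),
        G (PadicInt.toZModPow (n + cyclotomicExponent p) ((ζ : ℤ_[p]ˣ) : ℤ_[p]) *
          (cyclotomicGenerator p : ZMod (p ^ (n + cyclotomicExponent p))) ^ s.val) := by
    unfold padicLMinusBranchRiemannSum
    refine finsum_congr fun ζ ↦ Finset.sum_congr rfl fun s _ ↦ ?_
    rw [hG]
    dsimp only
    rw [RingHom.id_apply, teichWeight_classMap p i n ζ s, Nat.choose_zero_right, Nat.cast_one,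
      mul_one, mul_comm]
  rw [h1, finsum_sum_classes_eq_sum_units p n G]
  have h2 := sum_units_mul_of_distribution (μ := msdMinusMeasure f α) hdist (RingHom.id ℚ_[p]) he
    hle (teichWeight p i)
  rw [hG]
  dsimp only
  rw [h2]
  refine Finset.sum_congr rfl fun a _ ↦ ?_
  rw [RingHom.id_apply, teichWeight_units]

/-- **The constant term of the odd branch**:
`∫_{ℤ_p^×} ω^i dμ⁻_{f,α} = padicLMinusBranchCoeff f α i 0 = ∑_{a ∈ (ℤ/p^{e₀})ˣ} μ⁻_{f,α}(a + p^{e₀}ℤ_p) · ω(a)^i`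
(the Riemann sums are constant in `n`). Twin of `padicLBranchCoeff_zero_eq`.
[cite: MazurTateTeitelbaum1986Invent, §I.13] -/
theorem padicLMinusBranchCoeff_zero_eq
    (hdist : ∀ (n : ℕ) (a : ZMod (p ^ n)),
      ∑ b ∈ Finset.univ.filter (fun b : ZMod (p ^ (n + 1)) ↦
        ZMod.castHom (pow_dvd_pow p n.le_succ) (ZMod (p ^ n)) b = a), msdMinusMeasure f α (n + 1) b =
        msdMinusMeasure f α n a)
    (i : ℕ) :
    padicLMinusBranchCoeff f α i 0 =
      ∑ a : (ZMod (p ^ cyclotomicExponent p))ˣ,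
        msdMinusMeasure f α (cyclotomicExponent p) a *
          ((((teichRep p a : rootsOfUnity (torsionOrder p) ℤ_[p]) : ℤ_[p]ˣ) : ℤ_[p]) : ℚ_[p]) ^ i := by
  unfold padicLMinusBranchCoeff
  exact (tendsto_const_nhds.congr fun n ↦
    (padicLMinusBranchRiemannSum_zero_eq hdist i n).symm).limUnder_eq

/-- **The constant term of `L⁻_p(f, α, ω^i, T)` as a power series**:
`constantCoeff (padicLFunctionMinusBranch f α i) = ∑_{a ∈ (ℤ/p^{e₀})ˣ} μ⁻_{f,α}(a + p^{e₀}ℤ_p) ω(a)^i`.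
Twin of `constantCoeff_padicLFunctionBranch_eq`. [cite: MazurTateTeitelbaum1986Invent, §I.13] -/
theorem constantCoeff_padicLFunctionMinusBranch_eq
    (hdist : ∀ (n : ℕ) (a : ZMod (p ^ n)),
      ∑ b ∈ Finset.univ.filter (fun b : ZMod (p ^ (n + 1)) ↦
        ZMod.castHom (pow_dvd_pow p n.le_succ) (ZMod (p ^ n)) b = a), msdMinusMeasure f α (n + 1) b =
        msdMinusMeasure f α n a)
    (i : ℕ) :
    PowerSeries.constantCoeff (padicLFunctionMinusBranch f α i) =
      ∑ a : (ZMod (p ^ cyclotomicExponent p))ˣ,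
        msdMinusMeasure f α (cyclotomicExponent p) a *
          ((((teichRep p a : rootsOfUnity (torsionOrder p) ℤ_[p]) : ℤ_[p]ˣ) : ℤ_[p]) : ℚ_[p]) ^ i := by
  rw [constantCoeff_padicLFunctionMinusBranch, padicLMinusBranchCoeff_zero_eq hdist]

end MinusConstantTerm

end Literature.NumberTheory.EllipticCurves

end
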